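/-
Copyright (c) 2026 the pub-hodgecm-mathlib formalisation cell (harness21).  Prover seat hodgecm-mathlib-K2E4-p14 (g5), Track B ∕ K2-LIT, h413 =
`stmt-HodgeConjecture-24833`, line `K2_E1_TraceFormulaBeta`, campaign «EIS-RANK-ONE» rung R6f(ii) at `N = 2`; the `U(J₂)` twins of ED. 4∕ED. 5 of «EIS-R6-CM» in ONE file, dealt by
K2E1-plan (g3) 2026-09-04T06:07:26Z∕06:09:14Z («then the `_two` twins of ED. 4∕5 in one file if < 400 l.»).
-/
import Summits.HodgeConjecture.HodgeConjecture.Theorems.K2E1MaassSelbergCMTwo                   -- ★ p857759 (this seat): `maassSelberg_flatSectionU_two_adj`, `indicator_height_apply_eq` (every `N`)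
import Summits.HodgeConjecture.HodgeConjecture.Theorems.K2E1MaassSelbergCMThreeConstantTerms    -- ★ p857809 (this seat): the `N`-generic §1 tools (`borelConstantTerm_sub`, `hfin_of_norm_le`, …)
import Summits.HodgeConjecture.HodgeConjecture.Theorems.K2E1IntertwinedSectionInvariance       -- ★ p857524 (K2E1-p09 g4): `∫ f(w₀ v u g) = ∫ f(w₀ v g)` (`u ∈ N(𝔸)`, `u ∈ B(F)`), `N = 2` twins
import HarnessLib

/-!
# K2·E1 — `K2E1MaassSelbergCMTwoConstantTerms`: THE MAASS–SELBERG RELATION FOR FLAT SECTIONS OF `U(J₂)` — CONSTANT TERMS DISCHARGED, INTERTWINED COEFFICIENTS SPELLED OUT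
# (campaign «EIS-RANK-ONE», rung R6f(ii), the `N = 2` twins of ★ ED. 4 `…CMThreeConstantTerms` and ★ ED. 5 `…CMThreeIntertwined`)

Track B ∕ K2-LIT, crux h413 = `stmt-HodgeConjecture-24833`, route of record `HCCMUnconditional`; cell `hodgecm-mathlib`, squad K2, ENGINE E1.  Prover seat
`hodgecm-mathlib-K2E4-p14` (g5); dealt by K2E1-plan (g3) 2026-09-04T06:07:26Z∕06:09:14Z (REPORT-FIRST).  THEOREMS ONLY (no `def`, no `instance`, no notation, no named-fact hypothesis,
no `sorry`); lane `--supports stmt-HodgeConjecture-24833 --as helper` (count-neutral).  Closes no socket.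

THE MATHEMATICS [MoeglinWaldspurger1995, I.2.13, II.1.6–II.1.7, IV.2.1–IV.2.3; Arthur1980TraceFormulaII, §1, §4; Garrett2018, §2.8, §2.10–§2.11, §11.3].  `G = U(J₂)` (`2ρ_H = 1`, intertwined
exponent `1 − z`); word for word the `N = 3` files ★ p857809∕ED. 5 with `2 ↦ 1`.  §1: the cut-off domination `|𝟙_{H>T}(f′_{z′} + f̃′_{1−z′})| ≤ (C_φ′ + C_φ̃′·T^{1−2Re z′})·H^{Re z′}` and the
intertwined coefficient `φ̃_{a,b}(g) := (∫_{N(𝔸)} f_a(w₀ v g) dν)·H(g)^b` — Borel (parametric Bochner), left-`N(𝔸)`-∕`B(F)`-invariant (★ p857524 `…_two`), `φ̃_{a,a−1}·H^{1−a} = M(w₀) f_a`.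
§2 **`maassSelberg_flatSectionU_two_ct`** = ★ `maassSelberg_flatSectionU_two_adj` with `Λ′ := Λ^T E(f′_{z′})`, `ν(𝓕) = 1`, and `hCT`, `hCT′`, `hM′ψ` DISCHARGED (★ R3 `…_two` for `f_z`, `f′_{z′}`
and the cut-off `χ`; ★ R6c `…_two`; ★ R6a; `w₀⁻¹ = w₀` ★ `weylLongU_mul_weylLongU_two`; ★ R6b; ★ `pseudoEisenstein_eq_eisensteinSeriesU′` ∘ `finite_support_indicator_out_mul siegel_two`), named inputs
`hMf`∕`hMf′`, the Godement finiteness of `H^z`, `H^{z′}` (★ R3's spelling), `hint′`.  §3 **`maassSelberg_flatSectionU_two_int`** = §2 at `φ̃ := (M(w₀) f_z)·H^{z−1}`, `φ̃′` likewise: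
`hMf`∕`hMf′` by definition, three structural binders proved, boundedness (the flat growth `|M(w₀) f_z| ≤ C·H^{1−Re z}`, R5) NAMED as ruled for `N = 3`.
HONEST LABEL: HC_CM is proved only modulo the 7 printed citations (2 remaining named inputs: hLiu418 = `stmt-HodgeConjecture-24832`, h413 = `stmt-HodgeConjecture-24833`) until rung 0
closes; this file asserts no named fact and closes no socket.
References: [MoeglinWaldspurger1995] I.2.13, II.1.6–II.1.7, IV.2.1–IV.2.3 · [Arthur1980TraceFormulaII] §1, §4 · [Garrett2018] §1.11, §2.8, §2.10–§2.11, §11.3 · [Rogawski1990] §2.1–§2.2.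
-/

set_option autoImplicit false
-- the mandated namespace repeats the single-problem summit's segment (`HodgeConjecture.HodgeConjecture`)
set_option linter.dupNamespace false

noncomputable section

open MeasureTheory Measure NumberField IsDedekindDomain Set MulAction Filter Matrix
open scoped ENNReal NNReal ComplexConjugate MatrixGroups
open Literature.MeasureTheory.Group Literature.NumberTheory
open Literature.NumberTheory.Automorphic Literature.NumberTheory.Automorphic.UnitaryGroup AdelicGroupData
open Summit.HodgeConjecture.HodgeConjecture.Cruxes.H413.K2E1BorelEisensteinU
open Summit.HodgeConjecture.HodgeConjecture.Cruxes.H413.K2E1MaassSelbergBracketsThree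
open Summit.HodgeConjecture.HodgeConjecture.Cruxes.H413.K2E1MaassSelbergCMTwo
open Summit.HodgeConjecture.HodgeConjecture.Cruxes.H413.K2E1MaassSelbergCMThreeConstantTerms (borelConstantTerm_sub hfin_of_norm_le norm_flatSectionU_le_mul_norm_std)
open Summit.HodgeConjecture.HodgeConjecture.Cruxes.H413.K2E1IntertwinedSectionInvariance
open Summit.HodgeConjecture.HodgeConjecture.Cruxes.H413.K2E1TruncatedEisensteinExplicit (forall_arithmeticBorel_indicator constantTermTail_eisensteinSeriesU_eq finite_support_indicator_out_mul siegel_two)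
open Summit.HodgeConjecture.HodgeConjecture.Cruxes.H413.K2E1BorelCosetsDictionary (pseudoEisenstein_eq_eisensteinSeriesU' forall_arithmeticBorel_iff mem_arithmeticBorel_iff_of_toAdelic_eq)
open Summit.HodgeConjecture.HodgeConjecture.Cruxes.H413.K2E1EisensteinSeriesLeftRight (borelConstantTerm_eisensteinSeriesU_two)
open Summit.HodgeConjecture.HodgeConjecture.Cruxes.H413.K2E1TruncatedEisensteinConstantTerm (borelConstantTerm_truncation_eisensteinSeriesU_eq_zero_of_lt_two)
open Summit.HodgeConjecture.HodgeConjecture.Cruxes.H413.K2E1BorelHeightWeylUnipotent (not_lt_borelHeight_weylLongU_unipotent_mul)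
open Summit.HodgeConjecture.HodgeConjecture.Cruxes.H413.K2E1IntertwiningAdjoint (weylLongU_mul_weylLongU_two)

namespace Summit.HodgeConjecture.HodgeConjecture.Cruxes.H413.K2E1MaassSelbergCMTwoConstantTerms

variable {F E : Type} [Field F] [NumberField F] [Field E] [NumberField E] [Algebra F E] {c : E ≃ₐ[F] E} {N : ℕ} [NeZero N]

/-! ## §1 The `N = 2` cut-off domination and the intertwined coefficient on `U(J₂)` -/

/-- **`N = 2` CUT-OFF DOMINATION**: on `{H > T}`, `|α′|·H^{Re z′} + |α̃′|·H^{1−Re z′} ≤ (C_α′ + C_α̃′·T^{1−2Re z′})·H^{Re z′}` (`0 < T`, `1 ≤ 2Re z′`). [cite: MoeglinWaldspurger1995, II.1.5] -/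
theorem norm_indicator_lt_add_flatSectionU_le_two {α α' : (quasiSplit F E c N).Adelic → ℂ} {Cα Cα' : ℝ} (hα : ∀ x, ‖α x‖ ≤ Cα) (hα' : ∀ x, ‖α' x‖ ≤ Cα')
    {T : ℝ≥0} (hT : 0 < T) {z' : ℂ} (hz' : 1 ≤ 2 * z'.re) (y : (quasiSplit F E c N).Adelic) :
    ‖{y : (quasiSplit F E c N).Adelic | T < borelHeight y}.indicator (flatSectionU α z' + flatSectionU α' (1 - z')) y‖ ≤
      (Cα + Cα' * (T : ℝ) ^ (1 - 2 * z'.re)) * ‖flatSectionU (fun _ : (quasiSplit F E c N).Adelic => (1 : ℂ)) z' y‖ := by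
  have hpos : (0 : ℝ) < (borelHeight y : ℝ) := by exact_mod_cast borelHeight_pos y
  have h1 : ‖flatSectionU (fun _ : (quasiSplit F E c N).Adelic => (1 : ℂ)) z' y‖ = (borelHeight y : ℝ) ^ z'.re := by
    rw [flatSectionU_apply, one_mul, Complex.norm_cpow_eq_rpow_re_of_pos hpos]
  have hCα : 0 ≤ Cα := (norm_nonneg _).trans (hα y)
  have hCα' : 0 ≤ Cα' := (norm_nonneg _).trans (hα' y)
  have hTe : 0 ≤ (T : ℝ) ^ (1 - 2 * z'.re) := Real.rpow_nonneg (NNReal.coe_nonneg T) _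
  rw [h1]
  by_cases hy : T < borelHeight y
  · rw [indicator_of_mem (show y ∈ {y : (quasiSplit F E c N).Adelic | T < borelHeight y} from hy), Pi.add_apply]
    have hTH : (T : ℝ) ≤ (borelHeight y : ℝ) := le_of_lt (by exact_mod_cast hy)
    have h2re : ((1 : ℂ) - z').re = (1 - 2 * z'.re) + z'.re := by simp only [Complex.sub_re, Complex.one_re]; ring
    have hf : ‖flatSectionU α z' y‖ ≤ Cα * (borelHeight y : ℝ) ^ z'.re := by
      rw [flatSectionU_apply, norm_mul, Complex.norm_cpow_eq_rpow_re_of_pos hpos]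
      exact mul_le_mul_of_nonneg_right (hα y) (Real.rpow_nonneg hpos.le _)
    have hM : ‖flatSectionU α' (1 - z') y‖ ≤ Cα' * (T : ℝ) ^ (1 - 2 * z'.re) * (borelHeight y : ℝ) ^ z'.re := by
      rw [flatSectionU_apply, norm_mul, Complex.norm_cpow_eq_rpow_re_of_pos hpos, h2re, Real.rpow_add hpos, mul_assoc]
      exact mul_le_mul (hα' y) (mul_le_mul_of_nonneg_right (Real.rpow_le_rpow_of_nonpos (NNReal.coe_pos.2 hT) hTH (by linarith)) (Real.rpow_nonneg hpos.le _))
        (by positivity) hCα'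
    calc ‖flatSectionU α z' y + flatSectionU α' (1 - z') y‖ ≤ ‖flatSectionU α z' y‖ + ‖flatSectionU α' (1 - z') y‖ := norm_add_le _ _
      _ ≤ Cα * (borelHeight y : ℝ) ^ z'.re + Cα' * (T : ℝ) ^ (1 - 2 * z'.re) * (borelHeight y : ℝ) ^ z'.re := add_le_add hf hM
      _ = (Cα + Cα' * (T : ℝ) ^ (1 - 2 * z'.re)) * (borelHeight y : ℝ) ^ z'.re := by ring
  · rw [indicator_of_notMem (show y ∉ {y : (quasiSplit F E c N).Adelic | T < borelHeight y} from hy), norm_zero]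
    exact mul_nonneg (add_nonneg hCα (mul_nonneg hCα' hTe)) (Real.rpow_nonneg hpos.le _)


section Two

variable [MeasurableSpace (quasiSplit F E c 2).Adelic] [BorelSpace (quasiSplit F E c 2).Adelic]
variable [MeasurableSpace (AdeleRing (𝓞 E) E)ˣ] [BorelSpace (AdeleRing (𝓞 E) E)ˣ]

omit [MeasurableSpace (AdeleRing (𝓞 E) E)ˣ] [BorelSpace (AdeleRing (𝓞 E) E)ˣ] in
/-- **`φ̃` IS BOREL** for Borel `α` (`ν` a Haar measure on `N(𝔸_F)`): the parametric Bochner integral `g ↦ ∫ f_a(w₀ v g) dν(v)` of the jointly Borel integrand (Mathlib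
`StronglyMeasurable.integral_prod_left′`; `G(𝔸)`, `N(𝔸)` second countable, `ν` s-finite — Haar on the closed subgroup `N(𝔸)` of the locally compact `G(𝔸)`), times `H^b`.
[cite: MoeglinWaldspurger1995, II.1.6] -/
theorem measurable_intertwinedCoeff_two (ν : Measure ↥(adelicUnipotent F E c 2)) [ν.IsHaarMeasure] {α : (quasiSplit F E c 2).Adelic → ℂ} (hα : Measurable α) (a b : ℂ) :
    Measurable (fun g : (quasiSplit F E c 2).Adelic => (∫ v : ↥(adelicUnipotent F E c 2), flatSectionU α a ((quasiSplit F E c 2).toAdelic (weylLongU (c : E →+* E) (rfl : (StdForm.antidiagonal 2).over E = (StdForm.antidiagonal 2).over E)) * ((v : (quasiSplit F E c 2).Adelic) * g)) ∂ν) * ((borelHeight g : ℝ) : ℂ) ^ b) := by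
  haveI := secondCountableTopology_adeleRing E
  haveI := locallyCompactSpace_adeleRing' E
  haveI := t2Space_adeleRing_of_numberField E
  haveI : SecondCountableTopology (quasiSplit F E c 2).Adelic := inferInstanceAs (SecondCountableTopology (adelic F E c 2 ((StdForm.antidiagonal 2).over E)))
  haveI : LocallyCompactSpace (quasiSplit F E c 2).Adelic := inferInstanceAs (LocallyCompactSpace (adelic F E c 2 ((StdForm.antidiagonal 2).over E)))
  haveI : SecondCountableTopology ↥(adelicUnipotent F E c 2) := TopologicalSpace.Subtype.secondCountableTopology _
  have hNcl : IsClosed ((adelicUnipotent F E c 2 : Subgroup (quasiSplit F E c 2).Adelic) : Set (quasiSplit F E c 2).Adelic) := by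
    change IsClosed (⇑(adelicVal F E c 2 ((StdForm.antidiagonal 2).over E)) ⁻¹'
      ((upperUnitriangular (Fin 2) (AdeleRing (𝓞 E) E) : Subgroup (GL (Fin 2) (AdeleRing (𝓞 E) E))) : Set (GL (Fin 2) (AdeleRing (𝓞 E) E))))
    exact (isClosed_upperUnitriangular (R := AdeleRing (𝓞 E) E)).preimage continuous_subtype_val
  haveI : LocallyCompactSpace ↥(adelicUnipotent F E c 2) := hNcl.locallyCompactSpace
  have hF : Measurable fun q : ↥(adelicUnipotent F E c 2) × (quasiSplit F E c 2).Adelic => flatSectionU α a ((quasiSplit F E c 2).toAdelic (weylLongU (c : E →+* E) (rfl : (StdForm.antidiagonal 2).over E = (StdForm.antidiagonal 2).over E)) * ((q.1 : (quasiSplit F E c 2).Adelic) * q.2)) :=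
    (measurable_flatSectionU hα a).comp (continuous_const.mul ((continuous_subtype_val.comp continuous_fst).mul continuous_snd)).measurable
  exact (MeasureTheory.StronglyMeasurable.integral_prod_left' (μ := ν) hF.stronglyMeasurable).measurable.mul
    ((Complex.measurable_ofReal.comp measurable_borelHeight.coe_nnreal_real).pow_const _)

omit [MeasurableSpace (AdeleRing (𝓞 E) E)ˣ] [BorelSpace (AdeleRing (𝓞 E) E)ˣ] in
/-- **`φ̃` IS LEFT-`N(𝔸_F)`-INVARIANT** (whatever `α`): `N(𝔸)` is unimodular, so `∫ f(w₀ v (u g)) dν = ∫ f(w₀ v g) dν` (★ p857524), and `H(u g) = H(g)`. [cite: MoeglinWaldspurger1995, II.1.6] -/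
theorem intertwinedCoeff_unipotent_mul_two (ν : Measure ↥(adelicUnipotent F E c 2)) [ν.IsHaarMeasure] (α : (quasiSplit F E c 2).Adelic → ℂ) (a b : ℂ) :
    ∀ (n : unipotentInBorel F E c 2) (y : (quasiSplit F E c 2).Adelic), (fun g : (quasiSplit F E c 2).Adelic => (∫ v : ↥(adelicUnipotent F E c 2), flatSectionU α a ((quasiSplit F E c 2).toAdelic (weylLongU (c : E →+* E) (rfl : (StdForm.antidiagonal 2).over E = (StdForm.antidiagonal 2).over E)) * ((v : (quasiSplit F E c 2).Adelic) * g)) ∂ν) * ((borelHeight g : ℝ) : ℂ) ^ b) (((n : borelAdelic F E c 2) : (quasiSplit F E c 2).Adelic) * y) = (fun g : (quasiSplit F E c 2).Adelic => (∫ v : ↥(adelicUnipotent F E c 2), flatSectionU α a ((quasiSplit F E c 2).toAdelic (weylLongU (c : E →+* E) (rfl : (StdForm.antidiagonal 2).over E = (StdForm.antidiagonal 2).over E)) * ((v : (quasiSplit F E c 2).Adelic) * g)) ∂ν) * ((borelHeight g : ℝ) : ℂ) ^ b) y := by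
  intro n y
  have hn : ((n : borelAdelic F E c 2) : (quasiSplit F E c 2).Adelic) ∈ adelicUnipotent F E c 2 := (mem_unipotentInBorel_iff _).1 n.2
  have key := integral_weyl_mul_unipotent_mul_two ν (flatSectionU α a) hn y
  simp_rw [mul_assoc] at key; dsimp only; rw [borelHeight_unipotent_mul hn y, key]

omit [MeasurableSpace (AdeleRing (𝓞 E) E)ˣ] [BorelSpace (AdeleRing (𝓞 E) E)ˣ] in
/-- **`φ̃` IS LEFT-`B(F)`-INVARIANT** for Borel left-`B(F)`-invariant `α` (`c² = 1`, `c ≠ 1`): ★ p857524 `integral_weyl_mul_toAdelic_borelU_mul_two` (Levi decomposition, `w₀ T(F) w₀⁻¹ ⊆ T(F)`,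
conjugation by `B(F)` preserves `ν`) and `H(b g) = H(g)`. [cite: MoeglinWaldspurger1995, II.1.7] [cite: Garrett2018, §2.8] -/
theorem intertwinedCoeff_arithmeticBorel_mul_two (hc : c * c = 1) (hc1 : c ≠ 1) (ν : Measure ↥(adelicUnipotent F E c 2)) [ν.IsHaarMeasure] {α : (quasiSplit F E c 2).Adelic → ℂ} (hα : Measurable α)
    (hαB : ∀ b ∈ arithmeticBorel F E c 2, ∀ y : (quasiSplit F E c 2).Adelic, α ((b : (quasiSplit F E c 2).Adelic) * y) = α y) (a b : ℂ) :
    ∀ β₀ ∈ arithmeticBorel F E c 2, ∀ y : (quasiSplit F E c 2).Adelic, (fun g : (quasiSplit F E c 2).Adelic => (∫ v : ↥(adelicUnipotent F E c 2), flatSectionU α a ((quasiSplit F E c 2).toAdelic (weylLongU (c : E →+* E) (rfl : (StdForm.antidiagonal 2).over E = (StdForm.antidiagonal 2).over E)) * ((v : (quasiSplit F E c 2).Adelic) * g)) ∂ν) * ((borelHeight g : ℝ) : ℂ) ^ b) ((β₀ : (quasiSplit F E c 2).Adelic) * y) = (fun g : (quasiSplit F E c 2).Adelic => (∫ v : ↥(adelicUnipotent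 F E c 2), flatSectionU α a ((quasiSplit F E c 2).toAdelic (weylLongU (c : E →+* E) (rfl : (StdForm.antidiagonal 2).over E = (StdForm.antidiagonal 2).over E)) * ((v : (quasiSplit F E c 2).Adelic) * g)) ∂ν) * ((borelHeight g : ℝ) : ℂ) ^ b) y := by
  intro β₀ hβ₀ y
  have hfB : ∀ b ∈ arithmeticBorel F E c 2, ∀ x : (quasiSplit F E c 2).Adelic, flatSectionU α a ((b : (quasiSplit F E c 2).Adelic) * x) = flatSectionU α a x := fun b hb x => by
    rw [flatSectionU_apply, flatSectionU_apply, hαB b hb x, K2E1TruncatedEisensteinExplicit.borelHeight_arithmeticBorel_mul hb]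
  obtain ⟨b₀, hb₀⟩ := MonoidHom.mem_range.1 β₀.2
  have hb₀B := (mem_arithmeticBorel_iff_of_toAdelic_eq hb₀).1 hβ₀
  have key := integral_weyl_mul_toAdelic_borelU_mul_two hc hc1 ν (measurable_flatSectionU hα a) (forall_arithmeticBorel_iff.1 hfB) hb₀B y
  simp_rw [mul_assoc] at key; dsimp only; rw [K2E1TruncatedEisensteinExplicit.borelHeight_arithmeticBorel_mul hβ₀ y, ← hb₀, key]

omit [BorelSpace (quasiSplit F E c 2).Adelic] [MeasurableSpace (AdeleRing (𝓞 E) E)ˣ] [BorelSpace (AdeleRing (𝓞 E) E)ˣ] in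
/-- **`φ̃·H^{2−a} = M(w₀) f_a`** for `φ̃ = (M(w₀) f_a)·H^{a−2}`: `H > 0`, `H^{a−2}·H^{2−a} = H^0 = 1` — the named identity `hMf` of ★ ED. 4 holds by definition. [cite: MoeglinWaldspurger1995, II.1.6] -/
theorem flatSectionU_intertwinedCoeff_two (ν : Measure ↥(adelicUnipotent F E c 2)) (α : (quasiSplit F E c 2).Adelic → ℂ) (a : ℂ) (g : (quasiSplit F E c 2).Adelic) :
    flatSectionU (fun g : (quasiSplit F E c 2).Adelic => (∫ v : ↥(adelicUnipotent F E c 2), flatSectionU α a ((quasiSplit F E c 2).toAdelic (weylLongU (c : E →+* E) (rfl : (StdForm.antidiagonal 2).over E = (StdForm.antidiagonal 2).over E)) * ((v : (quasiSplit F E c 2).Adelic) * g)) ∂ν) * ((borelHeight g : ℝ) : ℂ) ^ (a - 1)) (1 - a) g = ∫ v : ↥(adelicUnipotent F E c 2), flatSectionU α a ((quasiSplit F E c 2).toAdelic (weylLongU (c : E →+* E) (rfl : (StdForm.antidiagonal 2).over E = (StdForm.antidiagonal 2).over E)) * ((v : (quasiSplit F E c 2).Adelic) * g)) ∂ν :=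 by
  have hne : ((borelHeight g : ℝ) : ℂ) ≠ 0 := Complex.ofReal_ne_zero.2 (ne_of_gt (by exact_mod_cast borelHeight_pos g))
  rw [flatSectionU_apply, mul_assoc, ← Complex.cpow_add _ _ hne, show a - 1 + (1 - a) = 0 by ring, Complex.cpow_zero, mul_one]

/-! ## §2 The `N = 2` twin of ED. 4: `hCT`, `hCT′`, `hM′ψ` discharged (`Λ′ := Λ^T E(f′_{z′})`, `ν(𝓕) = 1`) -/

/-- **THE MAASS–SELBERG RELATION FOR FLAT SECTIONS OF `U(J₂)` — CONSTANT TERMS DISCHARGED** (twin of ★ `maassSelberg_flatSectionU_three_ct`): ★ `maassSelberg_flatSectionU_two_adj` with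
`Λ′ := Λ^T E(f′_{z′})`, `ν(𝓕) = 1`, and `hCT`, `hCT′`, `hM′ψ` PROVED from ★ R3∕R6a∕R6b∕R6c at `N = 2` and the named flat-section intertwining identities `hMf`, `hMf′`.
[cite: MoeglinWaldspurger1995, I.2.13, II.1.7 and IV.2.1–IV.2.3] [cite: Arthur1980TraceFormulaII, §1 and §4] [cite: Garrett2018, §1.11, §2.10–§2.11 and §11.3] -/
theorem maassSelberg_flatSectionU_two_ct (hc : c * c = 1) (hc1 : c ≠ 1)
    (μ : Measure (quasiSplit F E c 2).automorphicQuotient) [(quasiSplit F E c 2).IsAutomorphicMeasure μ]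
    (νG : Measure (quasiSplit F E c 2).Adelic) [νG.IsHaarMeasure] [νG.IsInvInvariant]
    (μK : Measure ((standardMaximalCompactGL 2 E).comap (adelicVal F E c 2 ((StdForm.antidiagonal 2).over E)) : Subgroup (quasiSplit F E c 2).Adelic))
    [μK.IsHaarMeasure]
    (νI : Measure (AdeleRing (𝓞 E) E)ˣ) [νI.IsHaarMeasure]
    (hBK : ∀ g : (quasiSplit F E c 2).Adelic, ∃ b ∈ borelAdelic F E c 2, ∃ k : (quasiSplit F E c 2).Adelic,
      adelicVal F E c 2 ((StdForm.antidiagonal 2).over E) k ∈ standardMaximalCompactGL 2 E ∧ g = b * k)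
    {𝓕I : Set (AdeleRing (𝓞 E) E)ˣ} (h𝓕I : IsIdeleClassDomain E 𝓕I)
    (ν : Measure ↥(adelicUnipotent F E c 2)) [ν.IsHaarMeasure] [ν.IsInvInvariant]
    {𝓕 : Set ↥(adelicUnipotent F E c 2)} (h𝓕N : IsFundamentalDomain ↥(rationalUnipotent F E c 2) 𝓕 ν) (h𝓕1 : ν 𝓕 = 1) :
    ∃ cμ K : ℝ, 0 < cμ ∧ 0 < K ∧
      ∀ {β : (quasiSplit F E c 2).Adelic → ℝ≥0∞}, IsCoveringWeight ((arithmeticBorel F E c 2).map (quasiSplit F E c 2).arithmeticSubgroup.subtype) β →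
      ∀ {T : ℝ≥0}, 1 ≤ T →
      ∀ {φ φ' φt φt' : (quasiSplit F E c 2).Adelic → ℂ},
      Measurable φ →
        (∀ (n : unipotentInBorel F E c 2) (y : (quasiSplit F E c 2).Adelic), φ (((n : borelAdelic F E c 2) : (quasiSplit F E c 2).Adelic) * y) = φ y) →
        (∀ b ∈ arithmeticBorel F E c 2, ∀ y : (quasiSplit F E c 2).Adelic, φ ((b : (quasiSplit F E c 2).Adelic) * y) = φ y) →
      ∀ {Cφ : ℝ}, (∀ x, ‖φ x‖ ≤ Cφ) →
      Measurable φ' →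
        (∀ (n : unipotentInBorel F E c 2) (y : (quasiSplit F E c 2).Adelic), φ' (((n : borelAdelic F E c 2) : (quasiSplit F E c 2).Adelic) * y) = φ' y) →
        (∀ b ∈ arithmeticBorel F E c 2, ∀ y : (quasiSplit F E c 2).Adelic, φ' ((b : (quasiSplit F E c 2).Adelic) * y) = φ' y) →
      ∀ {Cφ' : ℝ}, (∀ x, ‖φ' x‖ ≤ Cφ') →
      Measurable φt →
        (∀ (n : unipotentInBorel F E c 2) (y : (quasiSplit F E c 2).Adelic), φt (((n : borelAdelic F E c 2) : (quasiSplit F E c 2).Adelic) * y) = φt y) →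
        (∀ b ∈ arithmeticBorel F E c 2, ∀ y : (quasiSplit F E c 2).Adelic, φt ((b : (quasiSplit F E c 2).Adelic) * y) = φt y) →
      ∀ {Cφt : ℝ}, (∀ x, ‖φt x‖ ≤ Cφt) →
      Measurable φt' →
        (∀ (n : unipotentInBorel F E c 2) (y : (quasiSplit F E c 2).Adelic), φt' (((n : borelAdelic F E c 2) : (quasiSplit F E c 2).Adelic) * y) = φt' y) →
        (∀ b ∈ arithmeticBorel F E c 2, ∀ y : (quasiSplit F E c 2).Adelic, φt' ((b : (quasiSplit F E c 2).Adelic) * y) = φt' y) →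
      ∀ {Cφt' : ℝ}, (∀ x, ‖φt' x‖ ≤ Cφt') →
      ∀ {z z' : ℂ}, 1 < z'.re → z'.re < z.re →
      -- NAMED: the flat-section intertwining identities `M(w₀) f_z = f̃_{2−z}`, `M(w₀) f′_{z′} = f̃′_{2−z′}` (R5) and the Godement finiteness of the STANDARD sections `H^z`, `H^{z′}` (R2∕R4a)
        (∀ g : (quasiSplit F E c 2).Adelic, ∫ v : ↥(adelicUnipotent F E c 2), flatSectionU φ z ((quasiSplit F E c 2).toAdelic (weylLongU (c : E →+* E) (rfl : (StdForm.antidiagonal 2).over E = (StdForm.antidiagonal 2).over E)) * ((v : (quasiSplit F E c 2).Adelic) * g)) ∂ν = flatSectionU φt (1 - z) g) →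
        (∀ g : (quasiSplit F E c 2).Adelic, ∫ v : ↥(adelicUnipotent F E c 2), flatSectionU φ' z' ((quasiSplit F E c 2).toAdelic (weylLongU (c : E →+* E) (rfl : (StdForm.antidiagonal 2).over E = (StdForm.antidiagonal 2).over E)) * ((v : (quasiSplit F E c 2).Adelic) * g)) ∂ν = flatSectionU φt' (1 - z') g) →
        (∀ g : (quasiSplit F E c 2).Adelic, ∫⁻ u in 𝓕, (∑' q : (quasiSplit F E c 2).quotientSubgroup ⧸ (borelAdelic F E c 2).subgroupOf (quasiSplit F E c 2).quotientSubgroup,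
            ‖flatSectionU (fun _ : (quasiSplit F E c 2).Adelic => (1 : ℂ)) z ((((q.out : (quasiSplit F E c 2).quotientSubgroup) : (quasiSplit F E c 2).Adelic))⁻¹ * (u : (quasiSplit F E c 2).Adelic) * g)‖ₑ) ∂ν < ∞) →
        (∀ g : (quasiSplit F E c 2).Adelic, ∫⁻ u in 𝓕, (∑' q : (quasiSplit F E c 2).quotientSubgroup ⧸ (borelAdelic F E c 2).subgroupOf (quasiSplit F E c 2).quotientSubgroup,
            ‖flatSectionU (fun _ : (quasiSplit F E c 2).Adelic => (1 : ℂ)) z' ((((q.out : (quasiSplit F E c 2).quotientSubgroup) : (quasiSplit F E c 2).Adelic))⁻¹ * (u : (quasiSplit F E c 2).Adelic) * g)‖ₑ) ∂ν < ∞) →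
        (∀ g : (quasiSplit F E c 2).Adelic,
          Summable fun q : Quotient (orbitRel ↥(borelU (c : E →+* E) ((StdForm.antidiagonal 2).over E)) ↥(unitaryGroupOfForm (c : E →+* E) ((StdForm.antidiagonal 2).over E))) =>
            flatSectionU φ z ((quasiSplit F E c 2).toAdelic (q.out : ↥(unitaryGroupOfForm (c : E →+* E) ((StdForm.antidiagonal 2).over E))) * g)) →
      -- the truncated second series `Λ′ := Λ^T E(f′_{z′})`: Borel, `G(F)`-invariant, bounded (★ R6e ∕ p857707 at CM), and its Eisenstein series integrable along `N(F)∖N(𝔸)·g` (R4a)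
        Measurable (truncation ν 𝓕 T (eisensteinSeriesU (flatSectionU φ' z'))) →
        (∀ (γ : (quasiSplit F E c 2).arithmeticSubgroup) (x : (quasiSplit F E c 2).Adelic), truncation ν 𝓕 T (eisensteinSeriesU (flatSectionU φ' z')) ((γ : (quasiSplit F E c 2).Adelic) * x) = truncation ν 𝓕 T (eisensteinSeriesU (flatSectionU φ' z')) x) →
        ∀ {M₁ : ℝ}, (∀ g, ‖truncation ν 𝓕 T (eisensteinSeriesU (flatSectionU φ' z')) g‖ ≤ M₁) →
        (∀ g : (quasiSplit F E c 2).Adelic, IntegrableOn (fun u : ↥(adelicUnipotent F E c 2) => eisensteinSeriesU (flatSectionU φ' z') ((u : (quasiSplit F E c 2).Adelic) * g)) 𝓕 ν) →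
        ∫⁻ g, β g * ‖({y : (quasiSplit F E c 2).Adelic | borelHeight y ≤ T}.indicator (flatSectionU φ z) g - {y : (quasiSplit F E c 2).Adelic | T < borelHeight y}.indicator (flatSectionU φt (1 - z)) g)‖ₑ ∂νG < ∞ →
        Integrable (fun g => (β g).toReal • (({y : (quasiSplit F E c 2).Adelic | borelHeight y ≤ T}.indicator (flatSectionU φ z) g - {y : (quasiSplit F E c 2).Adelic | T < borelHeight y}.indicator (flatSectionU φt (1 - z)) g) * conj (∫ u : ↥(adelicUnipotent F E c 2), {y : (quasiSplit F E c 2).Adelic | T < borelHeight y}.indicator (flatSectionU φ' z' + flatSectionU φt' (1 - z')) ((quasiSplit F E c 2).toAdelic (weylLongU (c : E →+* E) (rfl : (StdForm.antidiagonal 2).over E = (StdForm.antidiagonal 2).over E)) * ((u : (quasiSplit F E c 2).Adelic) * g)) ∂ν))) νG →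
      -- ★ p857605's absolute convergence (`h := χ`, `F := ψ`)
        ∫⁻ g, β g * ∫⁻ u : ↥(adelicUnipotent F E c 2), ‖{y : (quasiSplit F E c 2).Adelic | T < borelHeight y}.indicator (flatSectionU φ' z' + flatSectionU φt' (1 - z')) ((quasiSplit F E c 2).toAdelic (weylLongU (c : E →+* E) (rfl : (StdForm.antidiagonal 2).over E = (StdForm.antidiagonal 2).over E)) * ((u : (quasiSplit F E c 2).Adelic) * g)) * conj ({y : (quasiSplit F E c 2).Adelic | borelHeight y ≤ T}.indicator (flatSectionU φ z) g - {y : (quasiSplit F E c 2).Adelic | T < borelHeight y}.indicator (flatSectionU φt (1 - z)) g)‖ₑ ∂ν ∂νG < ∞ →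
        ∫⁻ g, β g * ∫⁻ u : ↥(adelicUnipotent F E c 2), ‖{y : (quasiSplit F E c 2).Adelic | T < borelHeight y}.indicator (flatSectionU φ' z' + flatSectionU φt' (1 - z')) g * conj ({y : (quasiSplit F E c 2).Adelic | borelHeight y ≤ T}.indicator (flatSectionU φ z) (((quasiSplit F E c 2).toAdelic (weylLongU (c : E →+* E) (rfl : (StdForm.antidiagonal 2).over E = (StdForm.antidiagonal 2).over E)))⁻¹ * ((u : (quasiSplit F E c 2).Adelic) * g)) - {y : (quasiSplit F E c 2).Adelic | T < borelHeight y}.indicator (flatSectionU φt (1 - z)) (((quasiSplit F E c 2).toAdelic (weylLongU (c : E →+* E) (rfl : (StdForm.antidiagonal 2).over E = (StdForm.antidiagonal 2).over E)))⁻¹ * ((u : (quasiSplit F E c 2).Adelic) * g)))‖ₑ ∂ν ∂νG < ∞ →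
      ∀ {Ξ₁ Ξ₂ Ξ₃ Ξ₄ : (AdeleRing (𝓞 E) E)ˣ → ℂ},
      Measurable Ξ₁ → ∀ {CΞ₁ : ℝ}, (∀ x, ‖Ξ₁ x‖ ≤ CΞ₁) → (∀ k ∈ GaloisRepresentations.principalIdeles E, ∀ x, Ξ₁ (k * x) = Ξ₁ x) →
        (∀ (r : ℝ≥0ˣ) (x : (AdeleRing (𝓞 E) E)ˣ), Ξ₁ (posRealIdele E r * x) = Ξ₁ x) →
        (∀ t : torusInBorel F E c 2,
          ∫ k, φ (((t : borelAdelic F E c 2) : (quasiSplit F E c 2).Adelic) * (k : (quasiSplit F E c 2).Adelic)) *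
              conj (φ' (((t : borelAdelic F E c 2) : (quasiSplit F E c 2).Adelic) * (k : (quasiSplit F E c 2).Adelic))) ∂μK = Ξ₁ (diagUnit (t : borelAdelic F E c 2).2 0)) →
      Measurable Ξ₂ → ∀ {CΞ₂ : ℝ}, (∀ x, ‖Ξ₂ x‖ ≤ CΞ₂) → (∀ k ∈ GaloisRepresentations.principalIdeles E, ∀ x, Ξ₂ (k * x) = Ξ₂ x) →
        (∀ (r : ℝ≥0ˣ) (x : (AdeleRing (𝓞 E) E)ˣ), Ξ₂ (posRealIdele E r * x) = Ξ₂ x) →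
        (∀ t : torusInBorel F E c 2,
          ∫ k, φ (((t : borelAdelic F E c 2) : (quasiSplit F E c 2).Adelic) * (k : (quasiSplit F E c 2).Adelic)) *
              conj (φt' (((t : borelAdelic F E c 2) : (quasiSplit F E c 2).Adelic) * (k : (quasiSplit F E c 2).Adelic))) ∂μK = Ξ₂ (diagUnit (t : borelAdelic F E c 2).2 0)) →
      Measurable Ξ₃ → ∀ {CΞ₃ : ℝ}, (∀ x, ‖Ξ₃ x‖ ≤ CΞ₃) → (∀ k ∈ GaloisRepresentations.principalIdeles E, ∀ x, Ξ₃ (k * x) = Ξ₃ x) →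
        (∀ (r : ℝ≥0ˣ) (x : (AdeleRing (𝓞 E) E)ˣ), Ξ₃ (posRealIdele E r * x) = Ξ₃ x) →
        (∀ t : torusInBorel F E c 2,
          ∫ k, φt (((t : borelAdelic F E c 2) : (quasiSplit F E c 2).Adelic) * (k : (quasiSplit F E c 2).Adelic)) *
              conj (φ' (((t : borelAdelic F E c 2) : (quasiSplit F E c 2).Adelic) * (k : (quasiSplit F E c 2).Adelic))) ∂μK = Ξ₃ (diagUnit (t : borelAdelic F E c 2).2 0)) →
      Measurable Ξ₄ → ∀ {CΞ₄ : ℝ}, (∀ x, ‖Ξ₄ x‖ ≤ CΞ₄) → (∀ k ∈ GaloisRepresentations.principalIdeles E, ∀ x, Ξ₄ (k * x) = Ξ₄ x) →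
        (∀ (r : ℝ≥0ˣ) (x : (AdeleRing (𝓞 E) E)ˣ), Ξ₄ (posRealIdele E r * x) = Ξ₄ x) →
        (∀ t : torusInBorel F E c 2,
          ∫ k, φt (((t : borelAdelic F E c 2) : (quasiSplit F E c 2).Adelic) * (k : (quasiSplit F E c 2).Adelic)) *
              conj (φt' (((t : borelAdelic F E c 2) : (quasiSplit F E c 2).Adelic) * (k : (quasiSplit F E c 2).Adelic))) ∂μK = Ξ₄ (diagUnit (t : borelAdelic F E c 2).2 0)) →
        ∫ x, (quasiSplit F E c 2).quotFun (truncation ν 𝓕 T (eisensteinSeriesU (flatSectionU φ z))) x * conj ((quasiSplit F E c 2).quotFun (truncation ν 𝓕 T (eisensteinSeriesU (flatSectionU φ' z'))) x) ∂μ =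
          (cμ : ℂ) * ((K : ℂ) *
            ((((T : ℝ) : ℂ) ^ (z + conj z' - 1) / (z + conj z' - 1)) * (∫ x in {x : (AdeleRing (𝓞 E) E)ˣ | (IdeleClassGroup.ideleNorm E x : ℝ) ≤ 1} ∩ 𝓕I, ((IdeleClassGroup.ideleNorm E x : ℝ) : ℂ) * Ξ₁ x ∂νI)
              + (((T : ℝ) : ℂ) ^ (z - conj z') / (z - conj z')) * (∫ x in {x : (AdeleRing (𝓞 E) E)ˣ | (IdeleClassGroup.ideleNorm E x : ℝ) ≤ 1} ∩ 𝓕I, ((IdeleClassGroup.ideleNorm E x : ℝ) : ℂ) * Ξ₂ x ∂νI)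
              - (((T : ℝ) : ℂ) ^ (-(z - conj z')) / (z - conj z')) * (∫ x in {x : (AdeleRing (𝓞 E) E)ˣ | (IdeleClassGroup.ideleNorm E x : ℝ) ≤ 1} ∩ 𝓕I, ((IdeleClassGroup.ideleNorm E x : ℝ) : ℂ) * Ξ₃ x ∂νI)
              - (((T : ℝ) : ℂ) ^ (-(z + conj z' - 1)) / (z + conj z' - 1)) * (∫ x in {x : (AdeleRing (𝓞 E) E)ˣ | (IdeleClassGroup.ideleNorm E x : ℝ) ≤ 1} ∩ 𝓕I, ((IdeleClassGroup.ideleNorm E x : ℝ) : ℂ) * Ξ₄ x ∂νI))) := by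
  have h𝓕₀ : ν 𝓕 ≠ 0 := by rw [h𝓕1]; exact one_ne_zero
  have h𝓕top : ν 𝓕 ≠ ∞ := by rw [h𝓕1]; exact ENNReal.one_ne_top
  obtain ⟨cμ, K, hcμ, hK, hAdj⟩ := maassSelberg_flatSectionU_two_adj hc hc1 μ νG μK νI hBK h𝓕I ν h𝓕N h𝓕₀ h𝓕top
  refine ⟨cμ, K, hcμ, hK, ?_⟩
  intro β hβ T hT φ φ' φt φt' hφm hφN hφB Cφ hφC hφ'm hφ'N hφ'B Cφ' hφ'C hφtm hφtN hφtB Cφt hφtC hφt'm hφt'N hφt'B Cφt' hφt'C z z' hz' hzz' hMf hMf' hfinz hfinz' hsum hΛm hΛG M₁ hΛbdd hint' hψL1 hi₅ habs habs'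
    Ξ₁ Ξ₂ Ξ₃ Ξ₄ hΞ₁m CΞ₁ hΞ₁C hΞ₁K hΞ₁M hΞ₁ hΞ₂m CΞ₂ hΞ₂C hΞ₂K hΞ₂M hΞ₂ hΞ₃m CΞ₃ hΞ₃C hΞ₃K hΞ₃M hΞ₃ hΞ₄m CΞ₄ hΞ₄C hΞ₄K hΞ₄M hΞ₄
  have hT0 : (0 : ℝ≥0) < T := lt_of_lt_of_le one_pos hT
  have hfB : ∀ {α : (quasiSplit F E c 2).Adelic → ℂ}, (∀ b ∈ arithmeticBorel F E c 2, ∀ y : (quasiSplit F E c 2).Adelic, α ((b : (quasiSplit F E c 2).Adelic) * y) = α y) →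
      ∀ (a : ℂ), ∀ b ∈ arithmeticBorel F E c 2, ∀ x : (quasiSplit F E c 2).Adelic, flatSectionU α a ((b : (quasiSplit F E c 2).Adelic) * x) = flatSectionU α a x := by
    intro α hαB a b hb x
    rw [flatSectionU_apply, flatSectionU_apply, hαB b hb x, K2E1TruncatedEisensteinExplicit.borelHeight_arithmeticBorel_mul hb]
  have hfN : ∀ {α : (quasiSplit F E c 2).Adelic → ℂ}, (∀ (n : unipotentInBorel F E c 2) (y : (quasiSplit F E c 2).Adelic), α (((n : borelAdelic F E c 2) : (quasiSplit F E c 2).Adelic) * y) = α y) →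
      ∀ (a : ℂ), ∀ u ∈ adelicUnipotent F E c 2, ∀ x : (quasiSplit F E c 2).Adelic, flatSectionU α a (u * x) = flatSectionU α a x := by
    intro α hαN a u hu x
    rw [flatSectionU_apply, flatSectionU_apply, hαN ⟨⟨u, adelicUnipotent_le_borelAdelic hu⟩, (mem_unipotentInBorel_iff _).2 hu⟩ x, borelHeight_unipotent_mul hu x]
  have hfN' : ∀ {α : (quasiSplit F E c 2).Adelic → ℂ}, (∀ (n : unipotentInBorel F E c 2) (y : (quasiSplit F E c 2).Adelic), α (((n : borelAdelic F E c 2) : (quasiSplit F E c 2).Adelic) * y) = α y) →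
      ∀ (a : ℂ) (u : ↥(adelicUnipotent F E c 2)) (x : (quasiSplit F E c 2).Adelic), flatSectionU α a ((u : (quasiSplit F E c 2).Adelic) * x) = flatSectionU α a x := fun hαN a u x => hfN hαN a u.1 u.2 x
  have hCφ : 0 ≤ Cφ := (norm_nonneg _).trans (hφC 1)
  have hCφ' : 0 ≤ Cφ' := (norm_nonneg _).trans (hφ'C 1)
  have hCφt' : 0 ≤ Cφt' := (norm_nonneg _).trans (hφt'C 1)
  have hw0i : (weylLongU (c : E →+* E) (rfl : (StdForm.antidiagonal 2).over E = (StdForm.antidiagonal 2).over E))⁻¹ = weylLongU (c : E →+* E) rfl :=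
    inv_eq_of_mul_eq_one_right (weylLongU_mul_weylLongU_two (c : E →+* E))
  have hW : ((quasiSplit F E c 2).toAdelic (weylLongU (c : E →+* E) (rfl : (StdForm.antidiagonal 2).over E = (StdForm.antidiagonal 2).over E)))⁻¹ = (quasiSplit F E c 2).toAdelic (weylLongU (c : E →+* E) (rfl : (StdForm.antidiagonal 2).over E = (StdForm.antidiagonal 2).over E)) := by
    rw [← map_inv]
    exact congrArg _ hw0i
  have hCTf : ∀ x : (quasiSplit F E c 2).Adelic, borelConstantTerm ν 𝓕 (eisensteinSeriesU (flatSectionU φ z)) x = flatSectionU φ z x + flatSectionU φt (1 - z) x := by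
    intro x
    rw [borelConstantTerm_eisensteinSeriesU_two ν (measurable_flatSectionU hφm z) (hfN' hφN z) (forall_arithmeticBorel_iff.1 (hfB hφB z)) h𝓕N h𝓕₀ h𝓕top x (hfin_of_norm_le hCφ (norm_flatSectionU_le_mul_norm_std hφC z) x (hfinz x)), h𝓕1, ENNReal.toReal_one, inv_one, one_smul]
    simp_rw [mul_assoc]; rw [hMf x]
  have hCTf' : ∀ x : (quasiSplit F E c 2).Adelic, borelConstantTerm ν 𝓕 (eisensteinSeriesU (flatSectionU φ' z')) x = flatSectionU φ' z' x + flatSectionU φt' (1 - z') x := by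
    intro x
    rw [borelConstantTerm_eisensteinSeriesU_two ν (measurable_flatSectionU hφ'm z') (hfN' hφ'N z') (forall_arithmeticBorel_iff.1 (hfB hφ'B z')) h𝓕N h𝓕₀ h𝓕top x (hfin_of_norm_le hCφ' (norm_flatSectionU_le_mul_norm_std hφ'C z') x (hfinz' x)), h𝓕1, ENNReal.toReal_one, inv_one, one_smul]
    simp_rw [mul_assoc]; rw [hMf' x]
  have hM'ψ : ∀ g : (quasiSplit F E c 2).Adelic, T < borelHeight g → (∫ u : ↥(adelicUnipotent F E c 2), ({y : (quasiSplit F E c 2).Adelic | borelHeight y ≤ T}.indicator (flatSectionU φ z) (((quasiSplit F E c 2).toAdelic (weylLongU (c : E →+* E) (rfl : (StdForm.antidiagonal 2).over E = (StdForm.antidiagonal 2).over E)))⁻¹ * ((u : (quasiSplit F E c 2).Adelic) * g)) - {y : (quasiSplit F E c 2).Adelic | T < borelHeight y}.indicator (flatSectionU φt (1 - z)) (((quasiSplit F E c 2).toAdelic (weylLongU (c : E →+* E) (rfl : (StdForm.antidiagonal 2).over E = (StdForm.antidiagonal 2).over E)))⁻¹ * ((u : (quasiSplit F E c 2).Adelic)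 * g))) ∂ν) = flatSectionU φt (1 - z) g := by
    intro g hg
    have hpt : ∀ u : ↥(adelicUnipotent F E c 2), {y : (quasiSplit F E c 2).Adelic | borelHeight y ≤ T}.indicator (flatSectionU φ z) (((quasiSplit F E c 2).toAdelic (weylLongU (c : E →+* E) (rfl : (StdForm.antidiagonal 2).over E = (StdForm.antidiagonal 2).over E)))⁻¹ * ((u : (quasiSplit F E c 2).Adelic) * g)) - {y : (quasiSplit F E c 2).Adelic | T < borelHeight y}.indicator (flatSectionU φt (1 - z)) (((quasiSplit F E c 2).toAdelic (weylLongU (c : E →+* E) (rfl : (StdForm.antidiagonal 2).over E = (StdForm.antidiagonal 2).over E)))⁻¹ * ((u : (quasiSplit F E c 2).Adelic) * g)) = flatSectionU φ z ((quasiSplit F E c 2).toAdelic (weylLongU (c : E →+* E) (rfl : (StdForm.antidiagonal 2).over E = (StdForm.antidiagonal 2).over E)) * ((u : (quasiSplit F E c 2).Adelic) * g)) := by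
      intro u
      have hnot := not_lt_borelHeight_weylLongU_unipotent_mul u.2 hT hg; rw [mul_assoc] at hnot
      rw [hW, indicator_of_mem (show (quasiSplit F E c 2).toAdelic (weylLongU (c : E →+* E) (rfl : (StdForm.antidiagonal 2).over E = (StdForm.antidiagonal 2).over E)) * ((u : (quasiSplit F E c 2).Adelic) * g) ∈ {y : (quasiSplit F E c 2).Adelic | borelHeight y ≤ T} from not_lt.1 hnot), indicator_of_notMem (show (quasiSplit F E c 2).toAdelic (weylLongU (c : E →+* E) (rfl : (StdForm.antidiagonal 2).over E = (StdForm.antidiagonal 2).over E)) * ((u : (quasiSplit F E c 2).Adelic) * g) ∉ {y : (quasiSplit F E c 2).Adelic | T < borelHeight y} from hnot), sub_zero]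
    simp_rw [hpt]; exact hMf g
  have hSgt : MeasurableSet {y : (quasiSplit F E c 2).Adelic | T < borelHeight y} := measurableSet_lt measurable_const measurable_borelHeight
  have hχm : Measurable ({y : (quasiSplit F E c 2).Adelic | T < borelHeight y}.indicator (flatSectionU φ' z' + flatSectionU φt' (1 - z'))) := ((measurable_flatSectionU hφ'm z').add (measurable_flatSectionU hφt'm (1 - z'))).indicator hSgt
  have hsumN : ∀ (u : ↥(adelicUnipotent F E c 2)) (x : (quasiSplit F E c 2).Adelic), (flatSectionU φ' z' + flatSectionU φt' (1 - z')) ((u : (quasiSplit F E c 2).Adelic) * x) = (flatSectionU φ' z' + flatSectionU φt' (1 - z')) x := fun u x => by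
    rw [Pi.add_apply, Pi.add_apply, hfN' hφ'N z' u x, hfN' hφt'N (1 - z') u x]
  have hχN : ∀ (u : ↥(adelicUnipotent F E c 2)) (x : (quasiSplit F E c 2).Adelic), {y : (quasiSplit F E c 2).Adelic | T < borelHeight y}.indicator (flatSectionU φ' z' + flatSectionU φt' (1 - z')) ((u : (quasiSplit F E c 2).Adelic) * x) = {y : (quasiSplit F E c 2).Adelic | T < borelHeight y}.indicator (flatSectionU φ' z' + flatSectionU φt' (1 - z')) x := fun u x =>
    (indicator_height_apply_eq (borelHeight_unipotent_mul u.2 x) (hsumN u x)).2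
  have hsumB : ∀ b ∈ arithmeticBorel F E c 2, ∀ x : (quasiSplit F E c 2).Adelic, (flatSectionU φ' z' + flatSectionU φt' (1 - z')) ((b : (quasiSplit F E c 2).Adelic) * x) = (flatSectionU φ' z' + flatSectionU φt' (1 - z')) x := fun b hb x => by
    rw [Pi.add_apply, Pi.add_apply, hfB hφ'B z' b hb x, hfB hφt'B (1 - z') b hb x]
  have hχB : ∀ b ∈ arithmeticBorel F E c 2, ∀ x : (quasiSplit F E c 2).Adelic, {y : (quasiSplit F E c 2).Adelic | T < borelHeight y}.indicator (flatSectionU φ' z' + flatSectionU φt' (1 - z')) ((b : (quasiSplit F E c 2).Adelic) * x) = {y : (quasiSplit F E c 2).Adelic | T < borelHeight y}.indicator (flatSectionU φ' z' + flatSectionU φt' (1 - z')) x := forall_arithmeticBorel_indicator hsumB (fun h => T < h)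
  have hfinχ := fun g : (quasiSplit F E c 2).Adelic => hfin_of_norm_le (add_nonneg hCφ' (mul_nonneg hCφt' (Real.rpow_nonneg (NNReal.coe_nonneg T) _)))
    (norm_indicator_lt_add_flatSectionU_le_two hφ'C hφt'C hT0 (by linarith : 1 ≤ 2 * z'.re)) g (hfinz' g)
  have hCT' : ∀ g : (quasiSplit F E c 2).Adelic, borelConstantTerm ν 𝓕 (truncation ν 𝓕 T (eisensteinSeriesU (flatSectionU φ' z'))) g =
      {y : (quasiSplit F E c 2).Adelic | borelHeight y ≤ T}.indicator (flatSectionU φ' z' + flatSectionU φt' (1 - z')) g - (∫ u : ↥(adelicUnipotent F E c 2), {y : (quasiSplit F E c 2).Adelic | T < borelHeight y}.indicator (flatSectionU φ' z' + flatSectionU φt' (1 - z')) ((quasiSplit F E c 2).toAdelic (weylLongU (c : E →+* E) (rfl : (StdForm.antidiagonal 2).over E = (StdForm.antidiagonal 2).over E)) * ((u : (quasiSplit F E c 2).Adelic) * g)) ∂ν) := by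
    intro g
    by_cases hg : T < borelHeight g
    · have h0 : (fun u : ↥(adelicUnipotent F E c 2) => {y : (quasiSplit F E c 2).Adelic | T < borelHeight y}.indicator (flatSectionU φ' z' + flatSectionU φt' (1 - z')) ((quasiSplit F E c 2).toAdelic (weylLongU (c : E →+* E) (rfl : (StdForm.antidiagonal 2).over E = (StdForm.antidiagonal 2).over E)) * ((u : (quasiSplit F E c 2).Adelic) * g))) = fun _ => 0 := funext fun u => by
        have hnot := not_lt_borelHeight_weylLongU_unipotent_mul u.2 hT hg; rw [mul_assoc] at hnot
        exact indicator_of_notMem (show (quasiSplit F E c 2).toAdelic (weylLongU (c : E →+* E) (rfl : (StdForm.antidiagonal 2).over E = (StdForm.antidiagonal 2).over E)) * ((u : (quasiSplit F E c 2).Adelic) * g) ∉ {y : (quasiSplit F E c 2).Adelic | T < borelHeight y} from hnot) _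
      rw [borelConstantTerm_truncation_eisensteinSeriesU_eq_zero_of_lt_two hT (hfB hφ'B z') (hfB hφt'B (1 - z')) (hfN hφ'N z') (hfN hφt'N (1 - z')) (fun x _ => hCTf' x) h𝓕₀ h𝓕top (hint' g) hg,
        indicator_of_notMem (show g ∉ {y : (quasiSplit F E c 2).Adelic | borelHeight y ≤ T} from fun h => (not_le.2 hg) h), h0, integral_zero, sub_zero]
    · have hle : borelHeight g ≤ T := not_lt.1 hg
      have hΛfun : truncation ν 𝓕 T (eisensteinSeriesU (flatSectionU φ' z')) = eisensteinSeriesU (flatSectionU φ' z') - pseudoEisenstein ({y : (quasiSplit F E c 2).Adelic | T < borelHeight y}.indicator (flatSectionU φ' z' + flatSectionU φt' (1 - z'))) := by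
        funext y; rw [Pi.sub_apply, truncation_def, constantTermTail_eisensteinSeriesU_eq (fun x _ => hCTf' x), ← Set.indicator_add']
      have hPfun : pseudoEisenstein ({y : (quasiSplit F E c 2).Adelic | T < borelHeight y}.indicator (flatSectionU φ' z' + flatSectionU φt' (1 - z'))) = eisensteinSeriesU ({y : (quasiSplit F E c 2).Adelic | T < borelHeight y}.indicator (flatSectionU φ' z' + flatSectionU φt' (1 - z'))) :=
        funext fun y => pseudoEisenstein_eq_eisensteinSeriesU' hχB y (finite_support_indicator_out_mul siegel_two hT _ y)
      have hmeas : Measurable fun u : ↥(adelicUnipotent F E c 2) => (u : (quasiSplit F E c 2).Adelic) * g := (continuous_subtype_val.mul continuous_const).measurable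
      have hIΛ : IntegrableOn (fun u : ↥(adelicUnipotent F E c 2) => truncation ν 𝓕 T (eisensteinSeriesU (flatSectionU φ' z')) ((u : (quasiSplit F E c 2).Adelic) * g)) 𝓕 ν :=
        Measure.integrableOn_of_bounded (M := M₁) h𝓕top (hΛm.comp hmeas).aestronglyMeasurable (Eventually.of_forall fun u => hΛbdd _)
      have hIP : IntegrableOn (fun u : ↥(adelicUnipotent F E c 2) => pseudoEisenstein ({y : (quasiSplit F E c 2).Adelic | T < borelHeight y}.indicator (flatSectionU φ' z' + flatSectionU φt' (1 - z'))) ((u : (quasiSplit F E c 2).Adelic) * g)) 𝓕 ν := by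
        have h' : (fun u : ↥(adelicUnipotent F E c 2) => pseudoEisenstein ({y : (quasiSplit F E c 2).Adelic | T < borelHeight y}.indicator (flatSectionU φ' z' + flatSectionU φt' (1 - z'))) ((u : (quasiSplit F E c 2).Adelic) * g)) =
            fun u : ↥(adelicUnipotent F E c 2) => eisensteinSeriesU (flatSectionU φ' z') ((u : (quasiSplit F E c 2).Adelic) * g) - truncation ν 𝓕 T (eisensteinSeriesU (flatSectionU φ' z')) ((u : (quasiSplit F E c 2).Adelic) * g) := by
          funext u; rw [hΛfun, Pi.sub_apply, sub_sub_cancel]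
        rw [h']; exact (hint' g).sub hIΛ
      rw [hΛfun, borelConstantTerm_sub ν 𝓕 g (hint' g) hIP, hCTf' g, hPfun,
        borelConstantTerm_eisensteinSeriesU_two ν hχm hχN (forall_arithmeticBorel_iff.1 hχB) h𝓕N h𝓕₀ h𝓕top g (hfinχ g), h𝓕1, ENNReal.toReal_one, inv_one, one_smul,
        indicator_of_notMem (show g ∉ {y : (quasiSplit F E c 2).Adelic | T < borelHeight y} from hg), zero_add, indicator_of_mem (show g ∈ {y : (quasiSplit F E c 2).Adelic | borelHeight y ≤ T} from hle), Pi.add_apply]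
      simp_rw [mul_assoc]
  exact hAdj hβ hT hφm hφN hφB hφC hφ'm hφ'N hφ'B hφ'C hφtm hφtN hφtB hφtC hφt'm hφt'N hφt'B hφt'C hz' hzz' (fun x _ => hCTf x) hsum hΛm hΛG hΛbdd hψL1 hCT' hM'ψ hi₅ habs habs' hΞ₁m hΞ₁C hΞ₁K hΞ₁M hΞ₁ hΞ₂m hΞ₂C hΞ₂K hΞ₂M hΞ₂ hΞ₃m hΞ₃C hΞ₃K hΞ₃M hΞ₃ hΞ₄m hΞ₄C hΞ₄K hΞ₄M hΞ₄


/-! ## §3 The `N = 2` twin of ED. 5: `φ̃`, `φ̃′` spelled out -/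

/-- **THE MAASS–SELBERG RELATION FOR FLAT SECTIONS OF `U(J₂)` — INTERTWINED COEFFICIENTS DEFINED** (twin of ★ `maassSelberg_flatSectionU_three_int`): §2 at `φ̃ := (M(w₀) f_z)·H^{z−1}`,
`φ̃′ := (M(w₀) f′_{z′})·H^{z′−1}` (§1); only their boundedness stays named among the coefficient facts. [cite: MoeglinWaldspurger1995, II.1.6–II.1.7 and IV.2.1–IV.2.3] [cite: Garrett2018, §2.8 and §11.3] -/
theorem maassSelberg_flatSectionU_two_int (hc : c * c = 1) (hc1 : c ≠ 1)
    (μ : Measure (quasiSplit F E c 2).automorphicQuotient) [(quasiSplit F E c 2).IsAutomorphicMeasure μ]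
    (νG : Measure (quasiSplit F E c 2).Adelic) [νG.IsHaarMeasure] [νG.IsInvInvariant]
    (μK : Measure ((standardMaximalCompactGL 2 E).comap (adelicVal F E c 2 ((StdForm.antidiagonal 2).over E)) : Subgroup (quasiSplit F E c 2).Adelic))
    [μK.IsHaarMeasure]
    (νI : Measure (AdeleRing (𝓞 E) E)ˣ) [νI.IsHaarMeasure]
    (hBK : ∀ g : (quasiSplit F E c 2).Adelic, ∃ b ∈ borelAdelic F E c 2, ∃ k : (quasiSplit F E c 2).Adelic,
      adelicVal F E c 2 ((StdForm.antidiagonal 2).over E) k ∈ standardMaximalCompactGL 2 E ∧ g = b * k)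
    {𝓕I : Set (AdeleRing (𝓞 E) E)ˣ} (h𝓕I : IsIdeleClassDomain E 𝓕I)
    (ν : Measure ↥(adelicUnipotent F E c 2)) [ν.IsHaarMeasure] [ν.IsInvInvariant]
    {𝓕 : Set ↥(adelicUnipotent F E c 2)} (h𝓕N : IsFundamentalDomain ↥(rationalUnipotent F E c 2) 𝓕 ν) (h𝓕1 : ν 𝓕 = 1) :
    ∃ cμ K : ℝ, 0 < cμ ∧ 0 < K ∧
      ∀ {β : (quasiSplit F E c 2).Adelic → ℝ≥0∞}, IsCoveringWeight ((arithmeticBorel F E c 2).map (quasiSplit F E c 2).arithmeticSubgroup.subtype) β →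
      ∀ {T : ℝ≥0}, 1 ≤ T →
      ∀ {φ φ' : (quasiSplit F E c 2).Adelic → ℂ},
      Measurable φ →
        (∀ (n : unipotentInBorel F E c 2) (y : (quasiSplit F E c 2).Adelic), φ (((n : borelAdelic F E c 2) : (quasiSplit F E c 2).Adelic) * y) = φ y) →
        (∀ b ∈ arithmeticBorel F E c 2, ∀ y : (quasiSplit F E c 2).Adelic, φ ((b : (quasiSplit F E c 2).Adelic) * y) = φ y) →
      ∀ {Cφ : ℝ}, (∀ x, ‖φ x‖ ≤ Cφ) →
      Measurable φ' →
        (∀ (n : unipotentInBorel F E c 2) (y : (quasiSplit F E c 2).Adelic), φ' (((n : borelAdelic F E c 2) : (quasiSplit F E c 2).Adelic) * y) = φ' y) →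
        (∀ b ∈ arithmeticBorel F E c 2, ∀ y : (quasiSplit F E c 2).Adelic, φ' ((b : (quasiSplit F E c 2).Adelic) * y) = φ' y) →
      ∀ {Cφ' : ℝ}, (∀ x, ‖φ' x‖ ≤ Cφ') →
      ∀ {z z' : ℂ}, 1 < z'.re → z'.re < z.re →
      -- NAMED: the flat growth of the INTERTWINED coefficients `φ̃ = (M f_z)·H^{z−2}`, `φ̃′` (R5: the standard intertwining integral `c(σ)·H^{2−σ}`), and the Godement finiteness of `H^z`, `H^{z′}`
        ∀ {Cφt : ℝ}, (∀ x, ‖(fun g : (quasiSplit F E c 2).Adelic => (∫ v : ↥(adelicUnipotent F E c 2), flatSectionU φ z ((quasiSplit F E c 2).toAdelic (weylLongU (c : E →+* E) (rfl : (StdForm.antidiagonal 2).over E = (StdForm.antidiagonal 2).over E)) * ((v : (quasiSplit F E c 2).Adelic) * g)) ∂ν) * ((borelHeight g : ℝ) : ℂ) ^ (z - 1)) x‖ ≤ Cφt) →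
        ∀ {Cφt' : ℝ}, (∀ x, ‖(fun g : (quasiSplit F E c 2).Adelic => (∫ v : ↥(adelicUnipotent F E c 2), flatSectionU φ' z' ((quasiSplit F E c 2).toAdelic (weylLongU (c : E →+* E) (rfl : (StdForm.antidiagonal 2).over E = (StdForm.antidiagonal 2).over E)) * ((v : (quasiSplit F E c 2).Adelic) * g)) ∂ν) * ((borelHeight g : ℝ) : ℂ) ^ (z' - 1)) x‖ ≤ Cφt') →
        (∀ g : (quasiSplit F E c 2).Adelic, ∫⁻ u in 𝓕, (∑' q : (quasiSplit F E c 2).quotientSubgroup ⧸ (borelAdelic F E c 2).subgroupOf (quasiSplit F E c 2).quotientSubgroup,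
            ‖flatSectionU (fun _ : (quasiSplit F E c 2).Adelic => (1 : ℂ)) z ((((q.out : (quasiSplit F E c 2).quotientSubgroup) : (quasiSplit F E c 2).Adelic))⁻¹ * (u : (quasiSplit F E c 2).Adelic) * g)‖ₑ) ∂ν < ∞) →
        (∀ g : (quasiSplit F E c 2).Adelic, ∫⁻ u in 𝓕, (∑' q : (quasiSplit F E c 2).quotientSubgroup ⧸ (borelAdelic F E c 2).subgroupOf (quasiSplit F E c 2).quotientSubgroup,
            ‖flatSectionU (fun _ : (quasiSplit F E c 2).Adelic => (1 : ℂ)) z' ((((q.out : (quasiSplit F E c 2).quotientSubgroup) : (quasiSplit F E c 2).Adelic))⁻¹ * (u : (quasiSplit F E c 2).Adelic) * g)‖ₑ) ∂ν < ∞) →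
        (∀ g : (quasiSplit F E c 2).Adelic,
          Summable fun q : Quotient (orbitRel ↥(borelU (c : E →+* E) ((StdForm.antidiagonal 2).over E)) ↥(unitaryGroupOfForm (c : E →+* E) ((StdForm.antidiagonal 2).over E))) =>
            flatSectionU φ z ((quasiSplit F E c 2).toAdelic (q.out : ↥(unitaryGroupOfForm (c : E →+* E) ((StdForm.antidiagonal 2).over E))) * g)) →
      -- the truncated second series `Λ′ := Λ^T E(f′_{z′})`: Borel, `G(F)`-invariant, bounded (★ R6e ∕ p857707 at CM), and its Eisenstein series integrable along `N(F)∖N(𝔸)·g` (R4a)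
        Measurable (truncation ν 𝓕 T (eisensteinSeriesU (flatSectionU φ' z'))) →
        (∀ (γ : (quasiSplit F E c 2).arithmeticSubgroup) (x : (quasiSplit F E c 2).Adelic), truncation ν 𝓕 T (eisensteinSeriesU (flatSectionU φ' z')) ((γ : (quasiSplit F E c 2).Adelic) * x) = truncation ν 𝓕 T (eisensteinSeriesU (flatSectionU φ' z')) x) →
        ∀ {M₁ : ℝ}, (∀ g, ‖truncation ν 𝓕 T (eisensteinSeriesU (flatSectionU φ' z')) g‖ ≤ M₁) →
        (∀ g : (quasiSplit F E c 2).Adelic, IntegrableOn (fun u : ↥(adelicUnipotent F E c 2) => eisensteinSeriesU (flatSectionU φ' z') ((u : (quasiSplit F E c 2).Adelic) * g)) 𝓕 ν) →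
        ∫⁻ g, β g * ‖({y : (quasiSplit F E c 2).Adelic | borelHeight y ≤ T}.indicator (flatSectionU φ z) g - {y : (quasiSplit F E c 2).Adelic | T < borelHeight y}.indicator (flatSectionU (fun g : (quasiSplit F E c 2).Adelic => (∫ v : ↥(adelicUnipotent F E c 2), flatSectionU φ z ((quasiSplit F E c 2).toAdelic (weylLongU (c : E →+* E) (rfl : (StdForm.antidiagonal 2).over E = (StdForm.antidiagonal 2).over E)) * ((v : (quasiSplit F E c 2).Adelic) * g)) ∂ν) * ((borelHeight g : ℝ) : ℂ) ^ (z - 1)) (1 - z)) g)‖ₑ ∂νG < ∞ →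
        Integrable (fun g => (β g).toReal • (({y : (quasiSplit F E c 2).Adelic | borelHeight y ≤ T}.indicator (flatSectionU φ z) g - {y : (quasiSplit F E c 2).Adelic | T < borelHeight y}.indicator (flatSectionU (fun g : (quasiSplit F E c 2).Adelic => (∫ v : ↥(adelicUnipotent F E c 2), flatSectionU φ z ((quasiSplit F E c 2).toAdelic (weylLongU (c : E →+* E) (rfl : (StdForm.antidiagonal 2).over E = (StdForm.antidiagonal 2).over E)) * ((v : (quasiSplit F E c 2).Adelic) * g)) ∂ν) * ((borelHeight g : ℝ) : ℂ) ^ (z - 1)) (1 - z)) g) * conj (∫ u : ↥(adelicUnipotent F E c 2), {y : (quasiSplit F E c 2).Adelic | T < borelHeight y}.indicator (flatSectionU φ' z' + flatSectionU (fun g : (quasiSplit F E c 2).Adelic => (∫ v : ↥(adelicUnipotent F E c 2), flatSectionU φ' z' ((quasiSplit F E c 2).toAdelic (weylLongU (c : E →+* E) (rfl : (StdForm.antidiagonal 2).over E = (StdForm.antidiagonal 2).over E)) * ((v : (quasiSplit F E c 2).Adelic) * g)) ∂ν) * ((borelHeight g : ℝ) : ℂ) ^ (z' - 1)) (1 - z'))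 ((quasiSplit F E c 2).toAdelic (weylLongU (c : E →+* E) (rfl : (StdForm.antidiagonal 2).over E = (StdForm.antidiagonal 2).over E)) * ((u : (quasiSplit F E c 2).Adelic) * g)) ∂ν))) νG →
      -- ★ p857605's absolute convergence (`h := χ`, `F := ψ`)
        ∫⁻ g, β g * ∫⁻ u : ↥(adelicUnipotent F E c 2), ‖{y : (quasiSplit F E c 2).Adelic | T < borelHeight y}.indicator (flatSectionU φ' z' + flatSectionU (fun g : (quasiSplit F E c 2).Adelic => (∫ v : ↥(adelicUnipotent F E c 2), flatSectionU φ' z' ((quasiSplit F E c 2).toAdelic (weylLongU (c : E →+* E) (rfl : (StdForm.antidiagonal 2).over E = (StdForm.antidiagonal 2).over E)) * ((v : (quasiSplit F E c 2).Adelic) * g)) ∂ν) * ((borelHeight g : ℝ) : ℂ) ^ (z' - 1)) (1 - z')) ((quasiSplit F E c 2).toAdelic (weylLongU (c : E →+* E) (rfl : (StdForm.antidiagonal 2).over E = (StdForm.antidiagonal 2).over E)) * ((u : (quasiSplit F E c 2).Adelic) * g)) * conj ({y : (quasiSplit F E c 2).Adelic | borelHeight y ≤ T}.indicator (flatSectionU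 φ z) g - {y : (quasiSplit F E c 2).Adelic | T < borelHeight y}.indicator (flatSectionU (fun g : (quasiSplit F E c 2).Adelic => (∫ v : ↥(adelicUnipotent F E c 2), flatSectionU φ z ((quasiSplit F E c 2).toAdelic (weylLongU (c : E →+* E) (rfl : (StdForm.antidiagonal 2).over E = (StdForm.antidiagonal 2).over E)) * ((v : (quasiSplit F E c 2).Adelic) * g)) ∂ν) * ((borelHeight g : ℝ) : ℂ) ^ (z - 1)) (1 - z)) g)‖ₑ ∂ν ∂νG < ∞ →
        ∫⁻ g, β g * ∫⁻ u : ↥(adelicUnipotent F E c 2), ‖{y : (quasiSplit F E c 2).Adelic | T < borelHeight y}.indicator (flatSectionU φ' z' + flatSectionU (fun g : (quasiSplit F E c 2).Adelic => (∫ v : ↥(adelicUnipotent F E c 2), flatSectionU φ' z' ((quasiSplit F E c 2).toAdelic (weylLongU (c : E →+* E) (rfl : (StdForm.antidiagonal 2).over E = (StdForm.antidiagonal 2).over E)) * ((v : (quasiSplit F E c 2).Adelic) * g)) ∂ν) * ((borelHeight g : ℝ) : ℂ) ^ (z' - 1)) (1 - z')) g * conj ({y : (quasiSplit F E c 2).Adelic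 | borelHeight y ≤ T}.indicator (flatSectionU φ z) (((quasiSplit F E c 2).toAdelic (weylLongU (c : E →+* E) (rfl : (StdForm.antidiagonal 2).over E = (StdForm.antidiagonal 2).over E)))⁻¹ * ((u : (quasiSplit F E c 2).Adelic) * g)) - {y : (quasiSplit F E c 2).Adelic | T < borelHeight y}.indicator (flatSectionU (fun g : (quasiSplit F E c 2).Adelic => (∫ v : ↥(adelicUnipotent F E c 2), flatSectionU φ z ((quasiSplit F E c 2).toAdelic (weylLongU (c : E →+* E) (rfl : (StdForm.antidiagonal 2).over E = (StdForm.antidiagonal 2).over E)) * ((v : (quasiSplit F E c 2).Adelic) * g)) ∂ν) * ((borelHeight g : ℝ) : ℂ) ^ (z - 1)) (1 - z)) (((quasiSplit F E c 2).toAdelic (weylLongU (c : E →+* E) (rfl : (StdForm.antidiagonal 2).over E = (StdForm.antidiagonal 2).over E)))⁻¹ * ((u : (quasiSplit F E c 2).Adelic) * g)))‖ₑ ∂ν ∂νG < ∞ →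
      ∀ {Ξ₁ Ξ₂ Ξ₃ Ξ₄ : (AdeleRing (𝓞 E) E)ˣ → ℂ},
      Measurable Ξ₁ → ∀ {CΞ₁ : ℝ}, (∀ x, ‖Ξ₁ x‖ ≤ CΞ₁) → (∀ k ∈ GaloisRepresentations.principalIdeles E, ∀ x, Ξ₁ (k * x) = Ξ₁ x) →
        (∀ (r : ℝ≥0ˣ) (x : (AdeleRing (𝓞 E) E)ˣ), Ξ₁ (posRealIdele E r * x) = Ξ₁ x) →
        (∀ t : torusInBorel F E c 2,
          ∫ k, φ (((t : borelAdelic F E c 2) : (quasiSplit F E c 2).Adelic) * (k : (quasiSplit F E c 2).Adelic)) *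
              conj (φ' (((t : borelAdelic F E c 2) : (quasiSplit F E c 2).Adelic) * (k : (quasiSplit F E c 2).Adelic))) ∂μK = Ξ₁ (diagUnit (t : borelAdelic F E c 2).2 0)) →
      Measurable Ξ₂ → ∀ {CΞ₂ : ℝ}, (∀ x, ‖Ξ₂ x‖ ≤ CΞ₂) → (∀ k ∈ GaloisRepresentations.principalIdeles E, ∀ x, Ξ₂ (k * x) = Ξ₂ x) →
        (∀ (r : ℝ≥0ˣ) (x : (AdeleRing (𝓞 E) E)ˣ), Ξ₂ (posRealIdele E r * x) = Ξ₂ x) →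
        (∀ t : torusInBorel F E c 2,
          ∫ k, φ (((t : borelAdelic F E c 2) : (quasiSplit F E c 2).Adelic) * (k : (quasiSplit F E c 2).Adelic)) *
              conj ((fun g : (quasiSplit F E c 2).Adelic => (∫ v : ↥(adelicUnipotent F E c 2), flatSectionU φ' z' ((quasiSplit F E c 2).toAdelic (weylLongU (c : E →+* E) (rfl : (StdForm.antidiagonal 2).over E = (StdForm.antidiagonal 2).over E)) * ((v : (quasiSplit F E c 2).Adelic) * g)) ∂ν) * ((borelHeight g : ℝ) : ℂ) ^ (z' - 1)) (((t : borelAdelic F E c 2) : (quasiSplit F E c 2).Adelic) * (k : (quasiSplit F E c 2).Adelic))) ∂μK = Ξ₂ (diagUnit (t : borelAdelic F E c 2).2 0)) →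
      Measurable Ξ₃ → ∀ {CΞ₃ : ℝ}, (∀ x, ‖Ξ₃ x‖ ≤ CΞ₃) → (∀ k ∈ GaloisRepresentations.principalIdeles E, ∀ x, Ξ₃ (k * x) = Ξ₃ x) →
        (∀ (r : ℝ≥0ˣ) (x : (AdeleRing (𝓞 E) E)ˣ), Ξ₃ (posRealIdele E r * x) = Ξ₃ x) →
        (∀ t : torusInBorel F E c 2,
          ∫ k, (fun g : (quasiSplit F E c 2).Adelic => (∫ v : ↥(adelicUnipotent F E c 2), flatSectionU φ z ((quasiSplit F E c 2).toAdelic (weylLongU (c : E →+* E) (rfl : (StdForm.antidiagonal 2).over E = (StdForm.antidiagonal 2).over E)) * ((v : (quasiSplit F E c 2).Adelic) * g)) ∂ν) * ((borelHeight g : ℝ) : ℂ) ^ (z - 1)) (((t : borelAdelic F E c 2) : (quasiSplit F E c 2).Adelic) * (k : (quasiSplit F E c 2).Adelic)) *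
              conj (φ' (((t : borelAdelic F E c 2) : (quasiSplit F E c 2).Adelic) * (k : (quasiSplit F E c 2).Adelic))) ∂μK = Ξ₃ (diagUnit (t : borelAdelic F E c 2).2 0)) →
      Measurable Ξ₄ → ∀ {CΞ₄ : ℝ}, (∀ x, ‖Ξ₄ x‖ ≤ CΞ₄) → (∀ k ∈ GaloisRepresentations.principalIdeles E, ∀ x, Ξ₄ (k * x) = Ξ₄ x) →
        (∀ (r : ℝ≥0ˣ) (x : (AdeleRing (𝓞 E) E)ˣ), Ξ₄ (posRealIdele E r * x) = Ξ₄ x) →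
        (∀ t : torusInBorel F E c 2,
          ∫ k, (fun g : (quasiSplit F E c 2).Adelic => (∫ v : ↥(adelicUnipotent F E c 2), flatSectionU φ z ((quasiSplit F E c 2).toAdelic (weylLongU (c : E →+* E) (rfl : (StdForm.antidiagonal 2).over E = (StdForm.antidiagonal 2).over E)) * ((v : (quasiSplit F E c 2).Adelic) * g)) ∂ν) * ((borelHeight g : ℝ) : ℂ) ^ (z - 1)) (((t : borelAdelic F E c 2) : (quasiSplit F E c 2).Adelic) * (k : (quasiSplit F E c 2).Adelic)) *
              conj ((fun g : (quasiSplit F E c 2).Adelic => (∫ v : ↥(adelicUnipotent F E c 2), flatSectionU φ' z' ((quasiSplit F E c 2).toAdelic (weylLongU (c : E →+* E) (rfl : (StdForm.antidiagonal 2).over E = (StdForm.antidiagonal 2).over E)) * ((v : (quasiSplit F E c 2).Adelic) * g)) ∂ν) * ((borelHeight g : ℝ) : ℂ) ^ (z' - 1)) (((t : borelAdelic F E c 2) : (quasiSplit F E c 2).Adelic) * (k : (quasiSplit F E c 2).Adelic))) ∂μK = Ξ₄ (diagUnit (t : borelAdelic F E c 2).2 0)) →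
        ∫ x, (quasiSplit F E c 2).quotFun (truncation ν 𝓕 T (eisensteinSeriesU (flatSectionU φ z))) x * conj ((quasiSplit F E c 2).quotFun (truncation ν 𝓕 T (eisensteinSeriesU (flatSectionU φ' z'))) x) ∂μ =
          (cμ : ℂ) * ((K : ℂ) *
            ((((T : ℝ) : ℂ) ^ (z + conj z' - 1) / (z + conj z' - 1)) * (∫ x in {x : (AdeleRing (𝓞 E) E)ˣ | (IdeleClassGroup.ideleNorm E x : ℝ) ≤ 1} ∩ 𝓕I, ((IdeleClassGroup.ideleNorm E x : ℝ) : ℂ) * Ξ₁ x ∂νI)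
              + (((T : ℝ) : ℂ) ^ (z - conj z') / (z - conj z')) * (∫ x in {x : (AdeleRing (𝓞 E) E)ˣ | (IdeleClassGroup.ideleNorm E x : ℝ) ≤ 1} ∩ 𝓕I, ((IdeleClassGroup.ideleNorm E x : ℝ) : ℂ) * Ξ₂ x ∂νI)
              - (((T : ℝ) : ℂ) ^ (-(z - conj z')) / (z - conj z')) * (∫ x in {x : (AdeleRing (𝓞 E) E)ˣ | (IdeleClassGroup.ideleNorm E x : ℝ) ≤ 1} ∩ 𝓕I, ((IdeleClassGroup.ideleNorm E x : ℝ) : ℂ) * Ξ₃ x ∂νI)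
              - (((T : ℝ) : ℂ) ^ (-(z + conj z' - 1)) / (z + conj z' - 1)) * (∫ x in {x : (AdeleRing (𝓞 E) E)ˣ | (IdeleClassGroup.ideleNorm E x : ℝ) ≤ 1} ∩ 𝓕I, ((IdeleClassGroup.ideleNorm E x : ℝ) : ℂ) * Ξ₄ x ∂νI))) := by
  obtain ⟨cμ, K, hcμ, hK, h4⟩ := maassSelberg_flatSectionU_two_ct hc hc1 μ νG μK νI hBK h𝓕I ν h𝓕N h𝓕1
  refine ⟨cμ, K, hcμ, hK, ?_⟩
  intro β hβ T hT φ φ' hφm hφN hφB Cφ hφC hφ'm hφ'N hφ'B Cφ' hφ'C z z' hz' hzz' Cφt hφtC Cφt' hφt'C hfinz hfinz' hsum hΛm hΛG M₁ hΛbdd hint' hψL1 hi₅ habs habs' Ξ₁ Ξ₂ Ξ₃ Ξ₄ hΞ₁m CΞ₁ hΞ₁C hΞ₁K hΞ₁M hΞ₁ hΞ₂m CΞ₂ hΞ₂C hΞ₂K hΞ₂M hΞ₂ hΞ₃m CΞ₃ hΞ₃C hΞ₃K hΞ₃M hΞ₃ hΞ₄m CΞ₄ hΞ₄C hΞ₄K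 hΞ₄M hΞ₄
  exact h4 hβ hT hφm hφN hφB hφC hφ'm hφ'N hφ'B hφ'C
    (measurable_intertwinedCoeff_two ν hφm z (z - 1)) (intertwinedCoeff_unipotent_mul_two ν φ z (z - 1)) (intertwinedCoeff_arithmeticBorel_mul_two hc hc1 ν hφm hφB z (z - 1)) hφtC
    (measurable_intertwinedCoeff_two ν hφ'm z' (z' - 1)) (intertwinedCoeff_unipotent_mul_two ν φ' z' (z' - 1)) (intertwinedCoeff_arithmeticBorel_mul_two hc hc1 ν hφ'm hφ'B z' (z' - 1)) hφt'C
    hz' hzz' (fun g => (flatSectionU_intertwinedCoeff_two ν φ z g).symm) (fun g => (flatSectionU_intertwinedCoeff_two ν φ' z' g).symm) hfinz hfinz' hsum hΛm hΛG hΛbdd hint' hψL1 hi₅ habs habs'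
    hΞ₁m hΞ₁C hΞ₁K hΞ₁M hΞ₁ hΞ₂m hΞ₂C hΞ₂K hΞ₂M hΞ₂ hΞ₃m hΞ₃C hΞ₃K hΞ₃M hΞ₃ hΞ₄m hΞ₄C hΞ₄K hΞ₄M hΞ₄

end Two

end Summit.HodgeConjecture.HodgeConjecture.Cruxes.H413.K2E1MaassSelbergCMTwoConstantTerms

end
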